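import Mathlib
import Literature.NumberTheory.NumberFields.PureCubicGenusRankLemmas
import HarnessLib

/-!
# Genus theory for pure cubic fields: the `3`-rank bound — linear disjointness of the cubic fields `k(ℓ)`

Topic `NumberTheory/NumberFields`.  Theorem-only file (no definition, no named fact, D-0026),
unconditional; continuation of `PureCubicGenusRankLemmas.lean`.  Inside a Galois number field
`M/ℚ` with group `Γ`, for subfields `F ↔ H_F = Gal(M/F)`:

* `Honda1971.finrank_sup_eq_three_mul` — for a Galois cubic subfield `C ⊄ F`:
  `[F C : ℚ] = 3 [F : ℚ]` (`H_{FC} = H_F ∩ H_C` and `[H_F : H_F ∩ H_C] = [H_F H_C : H_C] = 3`);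
* `Honda1971.finrank_biSup_eq_pow`, `Honda1971.finrank_iSup_eq_pow` — **Galois cubic subfields
  `C_i` ramified exactly above pairwise distinct primes `p_i` are linearly disjoint:
  `[C_1 ⋯ C_t : ℚ] = 3^t`.**  Induction: if `C_i ⊆ C_1 ⋯ C_{i-1}` then every inertia group
  `I(𝔔)`, `𝔔 ∣ p_i`, fixes the `C_j` (`j < i`, unramified at `p_i`:
  `isUnramifiedAt_under_iff_inertia_le`), hence their compositum, hence `C_i` — but `C_i` is
  ramified at some `𝔔 ∣ p_i`;
* `Honda1971.finrank_adjoin_cubeRoot_sup` — `[ℚ(β) C : ℚ] = 3 [C : ℚ]` for `β³ = m`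
  (`3 ∤ v_ℓ(m)`) and `C` Galois of odd degree (`X³ − m` has no root in `C`,
  `pow_three_ne_natCast_of_isGalois_of_odd`).

These are the degree computations behind "the genus group of `ℚ(∛m)` is the direct product of
cyclic groups of order `3` for the primes `p ≡ 1 (mod 3)` dividing the radicand" (Ishida, LNM 555,
Ch. 7, Thm. 7).

## References

* M. Ishida, *The genus fields of algebraic number fields*, LNM 555 (1976), Ch. 7, Thm. 7. [Ishida1976]
* D. A. Marcus, *Number Fields*, 2nd ed. (2018), Ch. 4, Thm. 28 and Ex. 29–31 (ramification in
  composita via inertia groups). [Marcus2018]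
-/

noncomputable section

open Polynomial NumberField IsDedekindDomain
open scoped IntermediateField nonZeroDivisors

namespace Literature.NumberTheory.NumberFields

namespace Honda1971

variable {M : Type*} [Field M] [NumberField M] [IsGalois ℚ M]

/-! ### Adjoining a Galois cubic field not already contained triples the degree -/

/-- For subfields `F, C` of a Galois number field `M/ℚ` with `C/ℚ` Galois cubic (i.e.
`H_C = Gal(M/C)` normal of index `3`) and `C ⊄ F`: `[F C : ℚ] = 3 · [F : ℚ]`.  (Galois
correspondence: `H_{FC} = H_F ∩ H_C`, and `[H_F : H_F ∩ H_C]` divides `[Γ : H_C] = 3` and is not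
`1`.)  The Galois hypothesis is phrased on the subgroup side to avoid the two (definitionally but
not reducibly equal) `ℚ`-algebra structures on a subfield. [folklore] -/
theorem finrank_sup_eq_three_mul (F C : IntermediateField ℚ M) [C.fixingSubgroup.Normal]
    (hC3 : Module.finrank ℚ C = 3) (hCF : ¬ C ≤ F) :
    Module.finrank ℚ (F ⊔ C : IntermediateField ℚ M) = 3 * Module.finrank ℚ F := by
  have hidx : C.fixingSubgroup.index = 3 := by
    rw [← IntermediateField.finrank_eq_fixingSubgroup_index, hC3]
  rw [IntermediateField.finrank_eq_fixingSubgroup_index,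
    IntermediateField.finrank_eq_fixingSubgroup_index, IntermediateField.fixingSubgroup_sup]
  have h1 := Subgroup.relIndex_mul_index
    (inf_le_left : F.fixingSubgroup ⊓ C.fixingSubgroup ≤ F.fixingSubgroup)
  rw [Subgroup.inf_relIndex_left] at h1
  have hdvd : C.fixingSubgroup.relIndex F.fixingSubgroup ∣ 3 :=
    hidx ▸ Subgroup.relIndex_dvd_index_of_normal _ _
  have hne : C.fixingSubgroup.relIndex F.fixingSubgroup ≠ 1 := by
    rw [Ne, Subgroup.relIndex_eq_one]
    intro hle
    apply hCF
    have h := (IntermediateField.le_iff_le (K := C) (H := F.fixingSubgroup)).mpr hle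
    rwa [IsGalois.fixedField_fixingSubgroup] at h
  have h3 : C.fixingSubgroup.relIndex F.fixingSubgroup = 3 :=
    ((Nat.dvd_prime Nat.prime_three).mp hdvd).resolve_left hne
  rw [← h1, h3]

/-! ### Linear disjointness of Galois cubic fields with distinct ramification -/

omit [NumberField M] [IsGalois ℚ M] in
/-- Two distinct rational primes do not lie in a common proper ideal of `𝓞 M`. [folklore] -/
theorem natCast_notMem_of_natCast_mem {p q : ℕ} (hp : p.Prime) (hq : q.Prime) (hpq : p ≠ q)
    (Q : Ideal (𝓞 M)) [Q.IsMaximal] (hpQ : (p : 𝓞 M) ∈ Q) : (q : 𝓞 M) ∉ Q := by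
  intro hqQ
  have hcop : IsCoprime (p : 𝓞 M) (q : 𝓞 M) := by
    have h' : IsCoprime (p : ℤ) (q : ℤ) :=
      Nat.isCoprime_iff_coprime.mpr ((Nat.coprime_primes hp hq).mpr hpq)
    simpa using h'.map (algebraMap ℤ (𝓞 M))
  obtain ⟨a, b, hab⟩ := hcop
  have h1 : (1 : 𝓞 M) ∈ Q := by
    rw [← hab]
    exact Q.add_mem (Q.mul_mem_left a hpQ) (Q.mul_mem_left b hqQ)
  exact (Ideal.IsMaximal.ne_top inferInstance) ((Ideal.eq_top_iff_one _).mpr h1)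

/-- **Linear disjointness of Galois cubic fields with pairwise distinct ramification** (finite-set
form).  Let `C_i ⊆ M` (`i ∈ ι`) be Galois cubic subfields and `p_i` pairwise distinct primes such
that `C_i` is unramified at the primes of `M` not above `p_i` and ramified at some prime of `M`
above `p_i`.  Then `[∏_{i ∈ T} C_i : ℚ] = 3^{#T}` for every finite `T ⊆ ι`. [cite: Ishida1976, Ch. 7 Thm. 7]
[cite: Marcus2018, Ch. 4 Thm. 28] -/
theorem finrank_biSup_eq_pow {ι : Type*} (C : ι → IntermediateField ℚ M) (p : ι → ℕ)
    (hp : Function.Injective p) (hprime : ∀ i, (p i).Prime)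
    (hnorm : ∀ i, (C i).fixingSubgroup.Normal) (h3 : ∀ i, Module.finrank ℚ (C i) = 3)
    (hunr : ∀ (i : ι) (Q : Ideal (𝓞 M)) [Q.IsMaximal], (p i : 𝓞 M) ∉ Q →
      Algebra.IsUnramifiedAt ℤ (Q.under (𝓞 (C i))))
    (hram : ∀ i, ∃ (Q : Ideal (𝓞 M)) (_ : Q.IsMaximal), (p i : 𝓞 M) ∈ Q ∧
      ¬ Algebra.IsUnramifiedAt ℤ (Q.under (𝓞 (C i))))
    (T : Finset ι) :
    Module.finrank ℚ (⨆ i ∈ T, C i : IntermediateField ℚ M) = 3 ^ T.card := by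
  classical
  induction T using Finset.induction_on with
  | empty =>
    rw [Finset.card_empty, pow_zero]
    have h : (⨆ i ∈ (∅ : Finset ι), C i : IntermediateField ℚ M) = ⊥ := by simp
    rw [h, IntermediateField.finrank_bot]
  | insert i T hi ih =>
    rw [Finset.card_insert_of_notMem hi, pow_succ]
    have hsup : (⨆ j ∈ insert i T, C j : IntermediateField ℚ M) = (⨆ j ∈ T, C j) ⊔ C i := by
      rw [Finset.iSup_insert, sup_comm]
    -- `C i` is not contained in the compositum of the `C j`, `j ∈ T`
    have key : ¬ C i ≤ ⨆ j ∈ T, C j := by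
      intro hle
      obtain ⟨Q, hQmax, hpQ, hnot⟩ := hram i
      apply hnot
      rw [isUnramifiedAt_under_iff_inertia_le]
      refine le_trans ?_ (IntermediateField.fixingSubgroup_antitone hle)
      rw [← IntermediateField.le_iff_le]
      refine iSup₂_le fun j hj => ?_
      rw [IntermediateField.le_iff_le, ← isUnramifiedAt_under_iff_inertia_le]
      have hji : j ≠ i := fun h => hi (h ▸ hj)
      exact hunr j Q (natCast_notMem_of_natCast_mem (hprime i) (hprime j)
        (fun h => hji (hp h).symm) Q hpQ)
    haveI := hnorm i
    rw [hsup, finrank_sup_eq_three_mul _ _ (h3 i) key, ih, mul_comm]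

/-- **Linear disjointness of Galois cubic fields with pairwise distinct ramification**:
`[C_1 ⋯ C_t : ℚ] = 3^t` (finite index type). [cite: Ishida1976, Ch. 7 Thm. 7] -/
theorem finrank_iSup_eq_pow {ι : Type*} [Fintype ι] (C : ι → IntermediateField ℚ M) (p : ι → ℕ)
    (hp : Function.Injective p) (hprime : ∀ i, (p i).Prime)
    (hnorm : ∀ i, (C i).fixingSubgroup.Normal) (h3 : ∀ i, Module.finrank ℚ (C i) = 3)
    (hunr : ∀ (i : ι) (Q : Ideal (𝓞 M)) [Q.IsMaximal], (p i : 𝓞 M) ∉ Q →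
      Algebra.IsUnramifiedAt ℤ (Q.under (𝓞 (C i))))
    (hram : ∀ i, ∃ (Q : Ideal (𝓞 M)) (_ : Q.IsMaximal), (p i : 𝓞 M) ∈ Q ∧
      ¬ Algebra.IsUnramifiedAt ℤ (Q.under (𝓞 (C i)))) :
    Module.finrank ℚ (⨆ i, C i : IntermediateField ℚ M) = 3 ^ Fintype.card ι := by
  classical
  have h := finrank_biSup_eq_pow C p hp hprime hnorm h3 hunr hram Finset.univ
  have huniv : (⨆ i ∈ (Finset.univ : Finset ι), C i : IntermediateField ℚ M) = ⨆ i, C i := by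
    simp
  rw [huniv, Finset.card_univ] at h
  exact h

/-! ### Adjoining the cube root -/

omit [IsGalois ℚ M] in
/-- **`[ℚ(β) · C : ℚ] = 3 [C : ℚ]`** for a cube root `β` of `m` (`3 ∤ v_ℓ(m)` for some prime `ℓ`)
and a subfield `C ⊆ M` Galois over `ℚ` of odd degree: `X³ − m` has no root in `C`
(`pow_three_ne_natCast_of_isGalois_of_odd`), so it is the minimal polynomial of `β` over `C`.
[folklore] -/
theorem finrank_adjoin_cubeRoot_sup (C : IntermediateField ℚ M) [IsGalois ℚ C]
    (hodd : Odd (Module.finrank ℚ C)) {ℓ m : ℕ} (hℓ : ℓ.Prime) (hm : ¬ 3 ∣ padicValNat ℓ m)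
    {β : M} (hβ3 : β ^ 3 = (m : M)) :
    Module.finrank ℚ (ℚ⟮β⟯ ⊔ C : IntermediateField ℚ M) = 3 * Module.finrank ℚ C := by
  classical
  have hcube : ∀ b : ℚ, b ^ 3 ≠ (m : ℚ) := pow_three_ne_of_not_dvd_padicValNat hℓ hm
  obtain ⟨f₁, hf₁def⟩ : ∃ f₁ : ℚ[X], f₁ = X ^ 3 - Polynomial.C (m : ℚ) := ⟨_, rfl⟩
  have hf₁monic : f₁.Monic := hf₁def ▸ monic_X_pow_sub_C _ (by norm_num)
  have hf₁0 : f₁ ≠ 0 := hf₁monic.ne_zero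
  have hf₁deg : f₁.natDegree = 3 := by rw [hf₁def, natDegree_X_pow_sub_C]
  have hminβ : minpoly ℚ β = f₁ := by
    rw [hf₁def]; exact minpoly_eq_of_not_dvd_padicValNat (K := M) hℓ hm hβ3
  have hirrC : Irreducible (f₁.map (algebraMap ℚ C)) := by
    have hdeg : (f₁.map (algebraMap ℚ C)).natDegree = 3 := by rw [natDegree_map, hf₁deg]
    have hne : f₁.map (algebraMap ℚ C) ≠ 0 := Polynomial.map_ne_zero hf₁0
    rw [irreducible_iff_roots_eq_zero_of_degree_le_three (by omega) (by omega),
      Multiset.eq_zero_iff_forall_notMem]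
    intro γ hγ
    rw [mem_roots hne, IsRoot.def, eval_map_algebraMap] at hγ
    have hγ3 : γ ^ 3 = (m : C) := by
      rw [hf₁def] at hγ
      simp only [map_natCast, aeval_sub, map_pow, aeval_X] at hγ
      exact sub_eq_zero.mp hγ
    exact pow_three_ne_natCast_of_isGalois_of_odd hodd hcube γ hγ3
  set E₃ : IntermediateField C M := IntermediateField.adjoin C {β} with hE₃def
  have hE' : E₃.restrictScalars ℚ = ℚ⟮β⟯ ⊔ C :=
    (IntermediateField.restrictScalars_adjoin_eq_sup ℚ C {β}).trans (sup_comm _ _)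
  have hE₃3 : Module.finrank C E₃ = 3 := by
    have hβintC : IsIntegral C β := .of_finite C β
    have hmin : minpoly C β = f₁.map (algebraMap ℚ C) := by
      refine (minpoly.eq_of_irreducible_of_monic hirrC ?_ (hf₁monic.map _)).symm
      rw [aeval_map_algebraMap, ← hminβ]
      exact minpoly.aeval ℚ β
    rw [hE₃def, IntermediateField.adjoin.finrank hβintC, hmin, natDegree_map, hf₁deg]
  have h9 : Module.finrank ℚ (E₃.restrictScalars ℚ) = 3 * Module.finrank ℚ C := by
    haveI : Module.Free C E₃ := Module.Free.of_divisionRing C E₃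
    haveI : Module.Free ℚ C := Module.Free.of_divisionRing ℚ C
    change Module.finrank ℚ E₃ = _
    rw [← Module.finrank_mul_finrank ℚ C E₃, hE₃3, mul_comm]
  rw [← h9]
  exact (IntermediateField.equivOfEq hE'.symm).toLinearEquiv.finrank_eq

end Honda1971

end Literature.NumberTheory.NumberFields

end
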